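import Literature.Probability.RandomPlanarGeometry.ConformalRemovabilityWhitneyGraph
import HarnessLib

/-!
# The quasihyperbolic boundary condition for the Whitney graph of a Hölder domain

P. W. Jones, S. K. Smirnov, *Removability theorems for Sobolev functions and quasiconformal maps*,
Ark. Mat. 38 (2000) 263–279. The proof of Thm. 3 (p. 275) introduces the graph of Whitney cubes
and `q(Q) := dist_graph(Q, Q₀) + 1`, and observes ("as is easily seen") that `q(Q)` is comparable
to the quasihyperbolic distance `k_Ω(Q, Q₀)`; for a Hölder domain the latter satisfies the
quasihyperbolic boundary condition `k_Ω(x, x₀) ≤ (1/α) log(1/dist(x, ∂Ω)) + O(1)` (Becker–Pommerenke;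
Cor. 4, p. 268: "Hölder domains … satisfy this quasihyperbolic boundary condition").

Here we prove the planar statement we need directly for the graph of Whitney discs of
`ConformalRemovabilityWhitneyGraph.lean`: if `φ : 𝔻 → Ω` is a conformal equivalence, Hölder
continuous with exponent `α`, `S` a Whitney family for the radius `dist(·, Ωᶜ)/100` and `x₀ ∈ S`
the centre of a disc containing `φ(0)`, then for every `x ∈ S`

  `dist_graph(x₀, x) ≤ (128000 π / α) log(1 / dist(x, Ωᶜ)) + B`      (`dist_le_log_of_holderOnWith`).

Proof: follow the image `γ(t) = φ(tζ)`, `0 ≤ t ≤ T`, of the radius ending at `x = φ(Tζ)`. Its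
quasihyperbolic length is `≤ 128π log(1/(1-T))` (`density_radial_le`, from the growth theorem with
Koebe constant `1/(128π)`), and `dist(x, Ωᶜ) ≤ C (1-T)^α` by the Hölder radial estimate
(`exists_radialLimit`). Cutting `[0, T]` into `N ≈ 1000 ·` (qh-length) pieces of quasihyperbolic
length `≤ 1/1000` (intermediate value theorem), consecutive points `γ(t_k)`, `γ(t_{k+1})` are so
close (`dist_radial_le_of_qh_short`, a first-exit-time argument) that the Whitney discs containing
them are equal or adjacent; hence `dist_graph(x₀, x) ≤ N + 2`.

Finally `exists_whitneyTree` packages, for a Hölder domain, the Whitney family together with the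
breadth-first tree of its graph (root, parent map, level function `q`, local finiteness, the
adjacency of each vertex to its parent) and the boundary condition above — the input of the
abstract shadow/ray combinatorics (`ConformalRemovabilityRays.lean` and its sequels).
-/

noncomputable section

open Set Metric MeasureTheory Filter

open scoped NNReal ENNReal Topology

namespace Literature.Probability.RandomPlanarGeometry

open Literature.Analysis.FluidPDE (IsWhitneyFamily exists_isWhitneyFamily)

variable {Ω : Set ℂ}

/-! ### Short quasihyperbolic steps are short -/

/-- **A radial arc of quasihyperbolic length `≤ 1/1000` is short**: if
`∫_a^b ‖(φ(sζ))'‖ / dist(φ(sζ), Ωᶜ) ds ≤ 1/1000` then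
`dist(φ(bζ), φ(aζ)) ≤ (3/2000) dist(φ(aζ), Ωᶜ)` (first exit time from the disc of half the
distance to the boundary, where the density is `≥ (2/3)/dist(φ(aζ), Ωᶜ)`). [folklore] -/
theorem dist_radial_le_of_qh_short (φ : ConformalEquiv (ball (0 : ℂ) 1) Ω) (hΩc : Ωᶜ.Nonempty)
    {ζ : ℂ} (hζ : ‖ζ‖ = 1) {a b : ℝ} (ha : 0 ≤ a) (hab : a ≤ b) (hb : b < 1)
    (hshort : ∫ s in a..b, ‖deriv φ (s * ζ) * ζ‖ / infDist (φ (s * ζ)) Ωᶜ ≤ 1 / 1000) :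
    dist (φ (b * ζ)) (φ (a * ζ)) ≤ 3 / 2000 * infDist (φ (a * ζ)) Ωᶜ := by
  have hΩo := isOpen_of_conformalEquiv_ball φ
  set d := infDist (φ (a * ζ)) Ωᶜ with hd
  have hmem : ∀ s : ℝ, 0 ≤ s → s < 1 → φ (s * ζ) ∈ Ω := fun s hs0 hs1 =>
    φ.mapsTo (ofReal_mul_mem_ball hζ hs0 hs1)
  have hdpos : 0 < d := infDist_compl_pos hΩo hΩc (hmem a ha (hab.trans_lt hb))
  set ρ : ℝ → ℝ := fun s => ‖deriv φ (s * ζ) * ζ‖ / infDist (φ (s * ζ)) Ωᶜ with hρ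
  set g : ℝ → ℝ := fun s => ‖φ (s * ζ) - φ (a * ζ)‖ with hg
  have hIcc : Icc a b ⊆ Ioo (-1 : ℝ) 1 := fun s hs => ⟨by linarith [hs.1], lt_of_le_of_lt hs.2 hb⟩
  have hgc : ContinuousOn g (Icc a b) :=
    (((continuousOn_radial φ hζ).mono hIcc).sub continuousOn_const).norm
  have hρc : ContinuousOn ρ (Icc a b) := (continuousOn_density_radial φ hΩc hζ).mono hIcc
  have hvc : ContinuousOn (fun s : ℝ => ‖deriv φ (s * ζ) * ζ‖) (Icc a b) :=
    ((continuousOn_deriv_radial φ hζ).mono hIcc).norm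
  have hρ0 : ∀ s, 0 ≤ ρ s := fun s => div_nonneg (norm_nonneg _) infDist_nonneg
  -- the estimate up to the first exit time
  have claim : ∀ s₁ ∈ Icc a b, (∀ σ ∈ Ico a s₁, g σ < d / 2) → g s₁ ≤ 3 / 2000 * d := by
    intro s₁ hs₁ hlt
    have has₁ : a ≤ s₁ := hs₁.1
    have hs₁1 : s₁ < 1 := lt_of_le_of_lt hs₁.2 hb
    have hsub : Icc a s₁ ⊆ Icc a b := Icc_subset_Icc le_rfl hs₁.2
    have i1 : g s₁ ≤ ∫ σ in a..s₁, ‖deriv φ (σ * ζ) * ζ‖ :=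
      norm_sub_radial_le_integral φ hζ ha has₁ hs₁1
    have hvi : IntervalIntegrable (fun s : ℝ => ‖deriv φ (s * ζ) * ζ‖) volume a s₁ :=
      (hvc.mono hsub).intervalIntegrable_of_Icc has₁
    have hρi : IntervalIntegrable ρ volume a s₁ := (hρc.mono hsub).intervalIntegrable_of_Icc has₁
    have i2 : ∫ σ in a..s₁, ‖deriv φ (σ * ζ) * ζ‖ ≤ ∫ σ in a..s₁, 3 * d / 2 * ρ σ := by
      refine intervalIntegral.integral_mono_ae_restrict has₁ hvi (hρi.const_mul _) ?_
      have hne : ∀ᵐ σ ∂(volume : Measure ℝ), σ ∉ ({s₁} : Set ℝ) :=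
        measure_eq_zero_iff_ae_notMem.1 Real.volume_singleton
      rw [Filter.EventuallyLE, ae_restrict_iff' measurableSet_Icc]
      filter_upwards [hne] with σ hσ hσI
      have hσs : σ ≠ s₁ := fun h => hσ (h ▸ mem_singleton _)
      have hσ' : σ ∈ Ico a s₁ := ⟨hσI.1, lt_of_le_of_ne hσI.2 hσs⟩
      have hpos : 0 < infDist (φ (σ * ζ)) Ωᶜ :=
        infDist_compl_pos hΩo hΩc (hmem σ (ha.trans hσI.1) (lt_of_le_of_lt hσI.2 hs₁1))
      have hle : infDist (φ (σ * ζ)) Ωᶜ ≤ 3 * d / 2 := by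
        have h1 := infDist_le_infDist_add_dist (s := Ωᶜ) (x := φ (σ * ζ)) (y := φ (a * ζ))
        have h2 := hlt σ hσ'
        simp only [hg, ← dist_eq_norm] at h2
        linarith
      calc ‖deriv φ (σ * ζ) * ζ‖ = ρ σ * infDist (φ (σ * ζ)) Ωᶜ := by
            simp only [hρ]; rw [div_mul_cancel₀ _ hpos.ne']
        _ ≤ ρ σ * (3 * d / 2) := mul_le_mul_of_nonneg_left hle (hρ0 σ)
        _ = 3 * d / 2 * ρ σ := mul_comm _ _
    have i3 : ∫ σ in a..s₁, 3 * d / 2 * ρ σ = 3 * d / 2 * ∫ σ in a..s₁, ρ σ :=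
      intervalIntegral.integral_const_mul _ _
    have i4 : ∫ σ in a..s₁, ρ σ ≤ ∫ σ in a..b, ρ σ := by
      refine intervalIntegral.integral_mono_interval le_rfl has₁ hs₁.2 ?_
        (hρc.intervalIntegrable_of_Icc hab)
      exact Filter.Eventually.of_forall fun σ => hρ0 σ
    have hd32 : 0 ≤ 3 * d / 2 := by positivity
    calc g s₁ ≤ 3 * d / 2 * ∫ σ in a..s₁, ρ σ := by linarith [i1, i2, i3]
      _ ≤ 3 * d / 2 * (1 / 1000) := mul_le_mul_of_nonneg_left (i4.trans hshort) hd32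
      _ = 3 / 2000 * d := by ring
  -- the first exit time from `B(φ(aζ), d/2)`, if any, contradicts the claim
  set A : Set ℝ := {s | s ∈ Icc a b ∧ d / 2 ≤ g s} with hA
  by_cases hAe : A = ∅
  · have := claim b (right_mem_Icc.2 hab) fun σ hσ => by
      by_contra hcon
      have hσA : σ ∈ A := ⟨⟨hσ.1, hσ.2.le⟩, not_lt.1 hcon⟩
      rw [hAe] at hσA
      exact hσA
    rw [dist_eq_norm]
    exact this
  · exfalso
    have hAne : A.Nonempty := Set.nonempty_iff_ne_empty.2 hAe
    have hAc : IsClosed A := by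
      have : A = Icc a b ∩ g ⁻¹' Ici (d / 2) := rfl
      rw [this]
      exact hgc.preimage_isClosed_of_isClosed isClosed_Icc isClosed_Ici
    have hbdd : BddBelow A := ⟨a, fun s hs => hs.1.1⟩
    have hs₁A : sInf A ∈ A := hAc.csInf_mem hAne hbdd
    have hlt : ∀ σ ∈ Ico a (sInf A), g σ < d / 2 := by
      intro σ hσ
      by_contra hcon
      have hσA : σ ∈ A := ⟨⟨hσ.1, hσ.2.le.trans hs₁A.1.2⟩, not_lt.1 hcon⟩
      have := csInf_le hbdd hσA
      linarith [hσ.2]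
    have h1 := claim (sInf A) hs₁A.1 hlt
    have h2 := hs₁A.2
    linarith

/-- Two points `x ∈ B(s, r(s))`, `y ∈ B(s', r(s'))` (`r = dist(·, Ωᶜ)/100`) with
`dist(y, x) ≤ (3/2000) dist(x, Ωᶜ)`: then `y` lies in both triple discs `B(s, 3r(s))`,
`B(s', 3r(s'))`, so the centres are equal or adjacent in the Whitney graph. [folklore] -/
theorem mem_triple_balls_of_close {x y s s' : ℂ} (hxs : x ∈ ball s (infDist s Ωᶜ / 100))
    (hys' : y ∈ ball s' (infDist s' Ωᶜ / 100)) (hxy : dist y x ≤ 3 / 2000 * infDist x Ωᶜ) :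
    y ∈ ball s (3 * (infDist s Ωᶜ / 100)) ∩ ball s' (3 * (infDist s' Ωᶜ / 100)) := by
  refine ⟨?_, ball_subset_ball (by linarith [infDist_nonneg (x := s') (s := Ωᶜ)]) hys'⟩
  rw [mem_ball] at hxs ⊢
  have h1 := infDist_le_infDist_add_dist (s := Ωᶜ) (x := x) (y := s)
  have h0 : 0 ≤ infDist s Ωᶜ := infDist_nonneg
  calc dist y s ≤ dist y x + dist x s := dist_triangle _ _ _
    _ < 3 * (infDist s Ωᶜ / 100) := by linarith

/-! ### The boundary condition for the graph distance -/

/-- **Quasihyperbolic boundary condition for the Whitney graph of a Hölder domain**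
(Jones–Smirnov 2000, proof of Thm. 3, p. 275, with Cor. 4, p. 268). Let `φ : 𝔻 → Ω` be a
conformal equivalence, Hölder continuous with constant `C` and exponent `α > 0`, `S` a Whitney
family of centres for the radius `dist(·, Ωᶜ)/100`, and `x₀ ∈ S` with `φ(0) ∈ B(x₀, r(x₀))`. Then
in the graph on `S` (centres adjacent iff their triple discs meet), for every `x ∈ S`,
`dist(x₀, x) ≤ (128000π/α) log(1/dist(x, Ωᶜ)) + (128000π/α) log(max(C, 1)) + 3`.
[cite: JonesSmirnov2000, proof of Thm. 3 (p. 275) and Cor. 4 (p. 268)] -/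
theorem dist_le_log_of_holderOnWith (φ : ConformalEquiv (ball (0 : ℂ) 1) Ω) {C α : ℝ≥0}
    (hα : 0 < α) (hH : HolderOnWith C α φ (ball (0 : ℂ) 1)) {S : Set ℂ}
    (hW : IsWhitneyFamily (fun z => infDist z Ωᶜ / 100) Ω S) (x₀ : S)
    (hx₀ : φ 0 ∈ ball (x₀ : ℂ) (infDist (x₀ : ℂ) Ωᶜ / 100)) (x : S) :
    ((SimpleGraph.fromRel fun a b : S =>
        (ball (a : ℂ) (3 * (infDist (a : ℂ) Ωᶜ / 100)) ∩
          ball (b : ℂ) (3 * (infDist (b : ℂ) Ωᶜ / 100))).Nonempty).dist x₀ x : ℝ) ≤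
      128000 * Real.pi / α * Real.log (1 / infDist (x : ℂ) Ωᶜ) +
        (128000 * Real.pi / α * Real.log (max C 1) + 3) := by
  classical
  set G := SimpleGraph.fromRel fun a b : S =>
    (ball (a : ℂ) (3 * (infDist (a : ℂ) Ωᶜ / 100)) ∩
      ball (b : ℂ) (3 * (infDist (b : ℂ) Ωᶜ / 100))).Nonempty with hG
  have hΩo := isOpen_of_conformalEquiv_ball φ
  have hΩc : Ωᶜ.Nonempty := compl_nonempty_of_holderOnWith φ hH
  have hrpos : ∀ z ∈ S, 0 < infDist z Ωᶜ / 100 := fun z hz =>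
    div_pos (infDist_compl_pos hΩo hΩc (hW.subset hz)) (by norm_num)
  have hΩpre : IsPreconnected Ω := by
    rw [← φ.bijOn.image_eq]
    exact (convex_ball (0 : ℂ) 1).isPreconnected.image _ φ.continuousOn
  have hconn : G.Connected :=
    connected_fromRel_of_cover hΩpre hW.subset hrpos hW.cover ⟨x₀, x₀.2⟩
  have hmem : ∀ {ζ : ℂ}, ‖ζ‖ = 1 → ∀ s : ℝ, 0 ≤ s → s < 1 → φ (s * ζ) ∈ Ω :=
    fun hζ s hs0 hs1 => φ.mapsTo (ofReal_mul_mem_ball hζ hs0 hs1)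
  -- equal-or-adjacent centres are at graph distance `≤ 1`
  have hdist1 : ∀ s₁ s₂ : S, (s₁ = s₂ ∨ G.Adj s₁ s₂) → G.dist x₀ s₂ ≤ G.dist x₀ s₁ + 1 := by
    rintro s₁ s₂ (h | h)
    · rw [h]; omega
    · have h1 : G.dist x₀ s₂ ≤ G.dist x₀ s₁ + G.dist s₁ s₂ := h.reachable.dist_triangle_right x₀
      rw [SimpleGraph.dist_eq_one_iff_adj.2 h] at h1
      exact h1
  -- two points of two Whitney discs, close to each other: the centres are equal or adjacent
  have hclose : ∀ (p₁ p₂ : ℂ) (s₁ s₂ : S), p₁ ∈ ball (s₁ : ℂ) (infDist (s₁ : ℂ) Ωᶜ / 100) →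
      p₂ ∈ ball (s₂ : ℂ) (infDist (s₂ : ℂ) Ωᶜ / 100) →
      dist p₂ p₁ ≤ 3 / 2000 * infDist p₁ Ωᶜ → s₁ = s₂ ∨ G.Adj s₁ s₂ := by
    intro p₁ p₂ s₁ s₂ h₁ h₂ h12
    by_cases hs : s₁ = s₂
    · exact Or.inl hs
    · refine Or.inr ?_
      rw [hG, SimpleGraph.fromRel_adj]
      exact ⟨hs, Or.inl ⟨p₂, mem_triple_balls_of_close h₁ h₂ h12⟩⟩
  -- the radius through `x`
  obtain ⟨ζ, T, hζ, hT0, hT1, hxT⟩ :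
      ∃ ζ : ℂ, ∃ T : ℝ, ‖ζ‖ = 1 ∧ 0 ≤ T ∧ T < 1 ∧ φ (T * ζ) = x := by
    set u := φ.symm x with hu
    have huB : u ∈ ball (0 : ℂ) 1 := φ.symm_mapsTo (hW.subset x.2)
    have hux : φ u = x := φ.apply_symm_apply (hW.subset x.2)
    by_cases h0 : u = 0
    · refine ⟨1, 0, by simp, le_rfl, one_pos, ?_⟩
      simpa [h0] using hux
    · have hn : (‖u‖ : ℂ) ≠ 0 := by exact_mod_cast norm_ne_zero_iff.2 h0
      refine ⟨u / ‖u‖, ‖u‖, ?_, norm_nonneg _, by simpa using huB, ?_⟩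
      · rw [norm_div, Complex.norm_real, Real.norm_eq_abs, abs_norm,
          div_self (norm_ne_zero_iff.2 h0)]
      · rw [← hux]
        congr 1
        field_simp
  -- the quasihyperbolic density along the radius and its integral
  set ρ : ℝ → ℝ := fun s => ‖deriv φ (s * ζ) * ζ‖ / infDist (φ (s * ζ)) Ωᶜ with hρ
  have hIcc : Icc 0 T ⊆ Ioo (-1 : ℝ) 1 := fun s hs => ⟨by linarith [hs.1], lt_of_le_of_lt hs.2 hT1⟩
  have hρc : ContinuousOn ρ (Icc 0 T) := (continuousOn_density_radial φ hΩc hζ).mono hIcc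
  have hρ0 : ∀ s, 0 ≤ ρ s := fun s => div_nonneg (norm_nonneg _) infDist_nonneg
  have hρi : ∀ a b : ℝ, 0 ≤ a → a ≤ b → b ≤ T → IntervalIntegrable ρ volume a b :=
    fun a b ha hab hb => (hρc.mono (Icc_subset_Icc ha hb)).intervalIntegrable_of_Icc hab
  set L : ℝ := ∫ s in (0 : ℝ)..T, ρ s with hL
  have hL0 : 0 ≤ L := intervalIntegral.integral_nonneg hT0 fun s _ => hρ0 s
  -- (i) the quasihyperbolic length of the radius
  have hLlog : L ≤ 128 * Real.pi * Real.log (1 / (1 - T)) := by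
    have hgc : ContinuousOn (fun s : ℝ => 128 * Real.pi * (1 / (1 - s))) (Icc 0 T) :=
      continuousOn_const.mul (continuousOn_const.div (continuousOn_const.sub continuousOn_id)
        fun s hs => sub_ne_zero.2 (ne_of_gt (lt_of_le_of_lt hs.2 hT1)))
    have h1 : L ≤ ∫ s in (0 : ℝ)..T, 128 * Real.pi * (1 / (1 - s)) := by
      refine intervalIntegral.integral_mono_on hT0 (hρi 0 T le_rfl hT0 le_rfl)
        (hgc.intervalIntegrable_of_Icc hT0) fun s hs => ?_
      have := density_radial_le φ hΩc hζ hs.1 (lt_of_le_of_lt hs.2 hT1)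
      simp only [hρ]
      rw [← div_eq_mul_one_div]
      exact this
    rwa [intervalIntegral.integral_const_mul, integral_inv_one_sub hT1] at h1
  -- (ii) the number of steps
  set N : ℕ := ⌊1000 * L⌋₊ + 1 with hN
  have hN0 : 0 < (N : ℝ) := by positivity
  have hNL : 1000 * L < N := by
    simp only [hN]
    push_cast
    exact Nat.lt_floor_add_one _
  have hNle : (N : ℝ) ≤ 1000 * L + 1 := by
    simp only [hN]
    push_cast
    linarith [Nat.floor_le (by positivity : 0 ≤ 1000 * L)]
  set c : ℝ := L / N with hc
  have hc0 : 0 ≤ c := div_nonneg hL0 hN0.le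
  have hc1 : c ≤ 1 / 1000 := by
    rw [hc, div_le_iff₀ hN0]
    linarith
  have hNc : (N : ℝ) * c = L := by rw [hc]; field_simp
  -- (iii) the subdivision points (intermediate value theorem)
  have hΛc : ContinuousOn (fun t => ∫ s in (0 : ℝ)..t, ρ s) (Icc 0 T) := by
    have := intervalIntegral.continuousOn_primitive_interval' (hρi 0 T le_rfl hT0 le_rfl)
      (left_mem_uIcc (a := (0 : ℝ)) (b := T))
    rwa [uIcc_of_le hT0] at this
  have hIVT : ∀ k : ℕ, ∃ t : ℝ, t ∈ Icc 0 T ∧ (k ≤ N → ∫ s in (0 : ℝ)..t, ρ s = k * c) := by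
    intro k
    by_cases hk : k ≤ N
    · have hkc : (k : ℝ) * c ∈ Icc (∫ s in (0 : ℝ)..(0 : ℝ), ρ s) (∫ s in (0 : ℝ)..T, ρ s) := by
        rw [intervalIntegral.integral_same]
        refine ⟨by positivity, ?_⟩
        calc (k : ℝ) * c ≤ N * c := by gcongr
          _ = L := hNc
      obtain ⟨t, ht, hteq⟩ := intermediate_value_Icc hT0 hΛc hkc
      exact ⟨t, ht, fun _ => hteq⟩
    · exact ⟨0, left_mem_Icc.2 hT0, fun h => (hk h).elim⟩
  choose t htI htΛ using hIVT
  -- (iv) Whitney discs containing the subdivision points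
  have hcen : ∀ k : ℕ, ∃ s : S, φ (t k * ζ) ∈ ball (s : ℂ) (infDist (s : ℂ) Ωᶜ / 100) := by
    intro k
    have hk : φ (t k * ζ) ∈ Ω := hmem hζ (t k) (htI k).1 (lt_of_le_of_lt (htI k).2 hT1)
    obtain ⟨s, hs, hks⟩ := mem_iUnion₂.1 (hW.cover hk)
    exact ⟨⟨s, hs⟩, hks⟩
  choose s hs using hcen
  -- (v) one step of quasihyperbolic length `≤ 1/1000`: the discs are equal or adjacent
  have hstep : ∀ (t₁ t₂ : ℝ) (s₁ s₂ : S), 0 ≤ t₁ → t₁ ≤ t₂ → t₂ ≤ T →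
      ∫ σ in t₁..t₂, ρ σ ≤ 1 / 1000 →
      φ (t₁ * ζ) ∈ ball (s₁ : ℂ) (infDist (s₁ : ℂ) Ωᶜ / 100) →
      φ (t₂ * ζ) ∈ ball (s₂ : ℂ) (infDist (s₂ : ℂ) Ωᶜ / 100) →
      G.dist x₀ s₂ ≤ G.dist x₀ s₁ + 1 ∧ G.dist x₀ s₁ ≤ G.dist x₀ s₂ + 1 := by
    intro t₁ t₂ s₁ s₂ h1 h12 h2 hint hb₁ hb₂
    have hd := dist_radial_le_of_qh_short φ hΩc hζ h1 h12 (lt_of_le_of_lt h2 hT1) hint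
    have h := hclose _ _ s₁ s₂ hb₁ hb₂ hd
    refine ⟨hdist1 s₁ s₂ h, hdist1 s₂ s₁ ?_⟩
    rcases h with h | h
    · exact Or.inl h.symm
    · exact Or.inr h.symm
  -- the integral between consecutive subdivision points
  have hdiff : ∀ t₁ t₂ : ℝ, t₁ ∈ Icc 0 T → t₂ ∈ Icc 0 T →
      ∫ σ in t₁..t₂, ρ σ = (∫ σ in (0 : ℝ)..t₂, ρ σ) - ∫ σ in (0 : ℝ)..t₁, ρ σ := by
    intro t₁ t₂ h₁ h₂
    rw [intervalIntegral.integral_interval_sub_left (hρi 0 t₂ le_rfl h₂.1 h₂.2)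
      (hρi 0 t₁ le_rfl h₁.1 h₁.2)]
  have hsucc : ∀ k, k < N → G.dist x₀ (s (k + 1)) ≤ G.dist x₀ (s k) + 1 := by
    intro k hk
    have e₁ := htΛ k hk.le
    have e₂ := htΛ (k + 1) hk
    rcases le_total (t k) (t (k + 1)) with hle | hle
    · refine (hstep (t k) (t (k + 1)) (s k) (s (k + 1)) (htI k).1 hle (htI (k + 1)).2 ?_
        (hs k) (hs (k + 1))).1
      rw [hdiff _ _ (htI k) (htI (k + 1)), e₁, e₂]
      push_cast
      nlinarith
    · refine (hstep (t (k + 1)) (t k) (s (k + 1)) (s k) (htI (k + 1)).1 hle (htI k).2 ?_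
        (hs (k + 1)) (hs k)).2
      rw [hdiff _ _ (htI (k + 1)) (htI k), e₁, e₂]
      push_cast
      nlinarith
  -- (vi) induction along the subdivision
  have hind : ∀ k, k ≤ N → G.dist x₀ (s k) ≤ G.dist x₀ (s 0) + k := by
    intro k
    induction k with
    | zero => intro; simp
    | succ k ih =>
      intro hk
      have := hsucc k hk
      have := ih (Nat.le_of_succ_le hk)
      omega
  -- (vii) the two ends
  have hstart : G.dist x₀ (s 0) ≤ 1 := by
    have h := (hstep 0 (t 0) x₀ (s 0) le_rfl (htI 0).1 (htI 0).2 ?_ (by simpa using hx₀) (hs 0)).1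
    · simpa using h
    · rw [htΛ 0 (Nat.zero_le _)]
      norm_num
  have hend : G.dist x₀ x ≤ G.dist x₀ (s N) + 1 := by
    refine (hstep (t N) T (s N) x (htI N).1 (htI N).2 le_rfl ?_ (hs N) ?_).1
    · rw [hdiff _ _ (htI N) (right_mem_Icc.2 hT0), htΛ N le_rfl, hNc, ← hL]
      norm_num
    · rw [hxT]
      exact mem_ball_self (hrpos x x.2)
  have hq : (G.dist x₀ x : ℝ) ≤ 1000 * L + 3 := by
    have h1 := hind N le_rfl
    have h2 : (G.dist x₀ x : ℝ) ≤ N + 2 := by exact_mod_cast (by omega : G.dist x₀ x ≤ N + 2)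
    linarith
  -- (viii) the Hölder radial estimate: `log(1/(1-T)) ≤ (log(max C 1) + log(1/dist(x, Ωᶜ)))/α`
  have hH' : HolderOnWith (max C 1) α φ (ball (0 : ℂ) 1) := fun a ha b hb =>
    (hH a ha b hb).trans (by gcongr; exact le_max_left C 1)
  obtain ⟨ξ, hξ, hξd⟩ := exists_radialLimit φ hα hH' hζ
  have hξc : ξ ∈ Ωᶜ := fun h => by
    have : ξ ∈ Ω ∩ frontier Ω := ⟨h, hξ⟩
    rw [hΩo.inter_frontier_eq] at this
    exact this
  have hdx : 0 < infDist (x : ℂ) Ωᶜ := infDist_compl_pos hΩo hΩc (hW.subset x.2)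
  have hC1 : (1 : ℝ) ≤ max C 1 := by exact_mod_cast le_max_right C 1
  have h1T : 0 < 1 - T := by linarith
  have hdle : infDist (x : ℂ) Ωᶜ ≤ (max C 1 : ℝ≥0) * (1 - T) ^ (α : ℝ) := by
    calc infDist (x : ℂ) Ωᶜ ≤ dist (x : ℂ) ξ := infDist_le_dist_of_mem hξc
      _ = dist (φ (T * ζ)) ξ := by rw [hxT]
      _ ≤ (max C 1 : ℝ≥0) * (1 - T) ^ (α : ℝ) := hξd T hT0 hT1
  have hlog : Real.log (1 / (1 - T)) ≤
      (Real.log (max C 1) + Real.log (1 / infDist (x : ℂ) Ωᶜ)) / α := by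
    have hα' : (0 : ℝ) < α := by exact_mod_cast hα
    rw [le_div_iff₀ hα', one_div, Real.log_inv, one_div, Real.log_inv]
    have h1 := Real.log_le_log hdx hdle
    rw [NNReal.coe_max, NNReal.coe_one, Real.log_mul (by positivity) (by positivity),
      Real.log_rpow h1T] at h1
    linarith
  -- conclusion
  have hA : 0 ≤ 128000 * Real.pi / (α : ℝ) := by positivity
  calc (G.dist x₀ x : ℝ) ≤ 1000 * L + 3 := hq
    _ ≤ 1000 * (128 * Real.pi * Real.log (1 / (1 - T))) + 3 := by linarith [hLlog]
    _ = 128000 * Real.pi * Real.log (1 / (1 - T)) + 3 := by ring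
    _ ≤ 128000 * Real.pi * ((Real.log (max C 1) + Real.log (1 / infDist (x : ℂ) Ωᶜ)) / α) + 3 := by
        gcongr
    _ = 128000 * Real.pi / α * Real.log (1 / infDist (x : ℂ) Ωᶜ) +
        (128000 * Real.pi / α * Real.log (max C 1) + 3) := by ring

/-! ### The rooted Whitney tree of a Hölder domain -/

/-- **The Whitney tree of a Hölder domain.** For a conformal equivalence `φ : 𝔻 → Ω`, Hölder
continuous with exponent `α > 0`, there are a Whitney family `S` for the radius
`r = dist(·, Ωᶜ)/100` (disjoint quarter discs, the discs cover `Ω`) and a rooted tree on `S` — a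
root, a parent map and a level function `q` (`q(root) = 0`, `q(v) = q(parent v) + 1`) — such
that every vertex is distinct from and adjacent to its parent (their triple discs meet), every
vertex has finitely many children, iterating the parent map leads to the root, and the levels
satisfy the quasihyperbolic boundary condition `q(v) ≤ A log(1/dist(v, Ωᶜ)) + B` with `A ≥ 0`
(the breadth-first tree of the Whitney graph; Jones–Smirnov 2000, p. 267 and proof of Thm. 3,
p. 275). [cite: JonesSmirnov2000, §1 p. 267 and proof of Thm. 3 p. 275] -/
theorem exists_whitneyTree (φ : ConformalEquiv (ball (0 : ℂ) 1) Ω) {C α : ℝ≥0} (hα : 0 < α)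
    (hH : HolderOnWith C α φ (ball (0 : ℂ) 1)) :
    ∃ S : Set ℂ, IsWhitneyFamily (fun z => infDist z Ωᶜ / 100) Ω S ∧
      ∃ (root : S) (parent : S → S) (q : ℂ → ℕ),
        q root = 0 ∧ parent root = root ∧
        (∀ v : S, v ≠ root → q v = q (parent v) + 1) ∧
        (∀ v : S, v ≠ root → (v : ℂ) ≠ parent v ∧
          (ball (v : ℂ) (3 * (infDist (v : ℂ) Ωᶜ / 100)) ∩
            ball (parent v : ℂ) (3 * (infDist (parent v : ℂ) Ωᶜ / 100))).Nonempty) ∧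
        (∀ v : S, {w : S | parent w = v ∧ w ≠ root}.Finite) ∧
        (∀ v : S, ∃ n, parent^[n] v = root) ∧
        ∃ A B : ℝ, 0 ≤ A ∧ ∀ v : S, (q v : ℝ) ≤ A * Real.log (1 / infDist (v : ℂ) Ωᶜ) + B := by
  classical
  have hΩo := isOpen_of_conformalEquiv_ball φ
  have hΩc : Ωᶜ.Nonempty := compl_nonempty_of_holderOnWith φ hH
  have hrpos : ∀ z ∈ Ω, 0 < infDist z Ωᶜ / 100 := fun z hz =>
    div_pos (infDist_compl_pos hΩo hΩc hz) (by norm_num)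
  -- the radius is bounded on `Ω`
  have hsubD : Ω ⊆ closedBall (φ 0) C := subset_closedBall_of_holderOnWith φ hH
  have hbd : ∀ z ∈ Ω, infDist z Ωᶜ / 100 ≤ 2 * C + 1 := by
    intro z hz
    have hp : φ 0 + ((C : ℝ) + 1 : ℝ) ∈ Ωᶜ := by
      intro h
      have := hsubD h
      rw [mem_closedBall, dist_eq_norm, add_sub_cancel_left, Complex.norm_real, Real.norm_eq_abs,
        abs_of_nonneg (by positivity)] at this
      linarith
    have h1 : infDist z Ωᶜ ≤ 2 * C + 1 :=
      calc infDist z Ωᶜ ≤ dist z (φ 0 + ((C : ℝ) + 1 : ℝ)) := infDist_le_dist_of_mem hp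
        _ ≤ dist z (φ 0) + dist (φ 0) (φ 0 + ((C : ℝ) + 1 : ℝ)) := dist_triangle _ _ _
        _ ≤ C + ((C : ℝ) + 1) := by
            gcongr
            · exact mem_closedBall.1 (hsubD hz)
            · rw [dist_eq_norm, sub_add_cancel_left, norm_neg, Complex.norm_real,
                Real.norm_eq_abs, abs_of_nonneg (by positivity)]
        _ = 2 * C + 1 := by ring
    linarith [infDist_nonneg (x := z) (s := Ωᶜ), C.coe_nonneg]
  obtain ⟨S, hW⟩ := exists_isWhitneyFamily hrpos hbd
  -- the root
  have h0 : φ 0 ∈ Ω := φ.mapsTo (mem_ball_self one_pos)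
  obtain ⟨x₀, hx₀S, hx₀⟩ := mem_iUnion₂.1 (hW.cover h0)
  set root : S := ⟨x₀, hx₀S⟩ with hroot
  set G := SimpleGraph.fromRel fun a b : S =>
    (ball (a : ℂ) (3 * (infDist (a : ℂ) Ωᶜ / 100)) ∩
      ball (b : ℂ) (3 * (infDist (b : ℂ) Ωᶜ / 100))).Nonempty with hG
  have hΩpre : IsPreconnected Ω := by
    rw [← φ.bijOn.image_eq]
    exact (convex_ball (0 : ℂ) 1).isPreconnected.image _ φ.continuousOn
  have hconn : G.Connected :=
    connected_fromRel_of_cover hΩpre hW.subset (fun z hz => hrpos z (hW.subset hz)) hW.cover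
      ⟨x₀, hx₀S⟩
  -- the breadth-first parent
  have hpar : ∀ v : S, ∃ w : S, (v ≠ root → G.Adj v w ∧ G.dist root v = G.dist root w + 1) ∧
      (v = root → w = root) := by
    intro v
    by_cases hv : v = root
    · exact ⟨root, fun h => (h hv).elim, fun _ => rfl⟩
    · obtain ⟨w, hw⟩ := exists_adj_dist_eq_dist_add_one hconn hv
      exact ⟨w, fun _ => hw, fun h => (hv h).elim⟩
  choose parent hparent hparent0 using hpar
  set q : ℂ → ℕ := fun z => if h : z ∈ S then G.dist root ⟨z, h⟩ else 0 with hq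
  have hqv : ∀ v : S, q v = G.dist root v := fun v => by simp [hq, dif_pos v.2]
  obtain ⟨A₀, B₀, hA₀, hAB⟩ : ∃ A B : ℝ, 0 ≤ A ∧ ∀ v : S, (G.dist root v : ℝ) ≤
      A * Real.log (1 / infDist (v : ℂ) Ωᶜ) + B :=
    ⟨_, _, by positivity, fun v => dist_le_log_of_holderOnWith φ hα hH hW root hx₀ v⟩
  refine ⟨S, hW, root, parent, q, ?_, hparent0 root rfl, ?_, ?_, ?_, ?_, A₀, B₀, hA₀,
    fun v => by rw [hqv]; exact hAB v⟩
  · rw [hqv]; exact SimpleGraph.dist_self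
  · intro v hv
    rw [hqv, hqv]
    exact (hparent v hv).2
  · intro v hv
    have hadj := (hparent v hv).1
    rw [hG, SimpleGraph.fromRel_adj] at hadj
    refine ⟨fun h => hadj.1 (Subtype.ext h), ?_⟩
    rcases hadj.2 with h | h
    · exact h
    · rw [inter_comm]; exact h
  · intro v
    have hfin := finite_triple_balls_meeting hΩo hΩc (S := S)
      (by simpa only [div_div] using hW.disjoint) (hW.subset v.2)
    refine (hfin.preimage (Subtype.val_injective.injOn)).subset ?_
    intro w hw
    have hw' : w ≠ root := hw.2
    have hadj := (hparent w hw').1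
    rw [hw.1, hG, SimpleGraph.fromRel_adj] at hadj
    refine ⟨w.2, ?_⟩
    rcases hadj.2 with h | h
    · rw [inter_comm]; exact h
    · exact h
  · intro v
    exact ⟨G.dist root v, iterate_parent_eq_root hconn (fun w hw => (hparent w hw).2) v⟩

end Literature.Probability.RandomPlanarGeometry
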